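import Summits.ResolutionOfSingularities.ResolutionOfSingularities.Theorems.PurelyInseparableDim4CurveBlind
import Summits.ResolutionOfSingularities.ResolutionOfSingularities.Theorems.PurelyInseparableDim4ScopeBlindMonomialCoat
import HarnessLib

/-!
# UNIFORM-OUT BY SUBSTITUTION: every point of a witness variety `Z = V(Q) ⊆ V(J_q⁺(G))` gives a BLIND translated state —
# `Q` killed by one fixed polynomial substitution, the point constrained by equations only (cell `res-dim4-pi`, ∀K column)

[OURS · counted 0 · frame bookkeeping] Nothing here is a statement about resolution of singularities.
Seat res-dim4-p-8 g3.  res-dim4-eng-w2 g2's «EN-9 on the exceptional divisor» (kit j321292, bus 2026-08-29 00:26Z) found, for the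
23 root-blocked roots of the (2,2) ∀K column, that every positive-dimensional NON-FLAT locus `Z` of `2`-fold points on `E` is
UNIFORM-OUT: some non-flat component `V(Q) ⊇ Z` of `V(J_q⁺(G))` passes through every point of `Z`, with small witnesses
`Q = (x_j, x₃ + x₄)`, `(x_j, x₃ + x₄²)`, `(x₂, x₃² + x₄³)`, ….  res-dim4-typ-3g8's `…CurveBlind` certifies blindness uniformly along
a PARAMETRISED curve with a Bezout witness.  Here the IMPLICIT version, natural for surfaces: the witness ideal is killed by a fixed
substitution `σ` (`x_j ↦ 0`, `x₃ ↦ −x₄`, …), the point `b` is ANY point with `σ(b) = b` (i.e. `b ∈ Z`), and non-containment in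
`(x_T)` is ONE uniform fact about `G`:

* §1 plumbing: `eval_aeval_mv`, `aeval_killT_translate` (killing the coordinates `x_T` commutes with the translation by `b` when
  `b_T = 0`), `translate_eq_zero_iff`;
* §2 **`not_inCoordinateScope_translate_of_subst`**: `G`, a substitution `σ : Fin 4 → K[x]` with `σ_i = 0` on `T` and `σ_i`
  non-constant off `T`, `aeval σ (D^{(α)}G) = 0` for `0 < |α| < q`, and ONE `α₀` with `(D^{(α₀)}G)(x_T ↦ 0) ≠ 0`; then for EVERY
  `b` with `eval b (σ i) = b i` the translated state `G(x + b)` is OUT of coordinate scope (prime `ker(aeval σ ∘ translate(−b))`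
  into res-dim4-p-3's `IsolationCert.not_inCoordinateScope_of_prime`); **`not_inCoordinateScope_step_of_subst`**: the same for
  the frame's child `CentreBlowup.step` (cleaning does not change `J_p⁺`);
* §3 acceptance (every field `K`, no `decide`): `G = x₁(x₃ + x₄)` — the plane `Z = {x₁ = 0, x₃ + x₄ = 0}` lies in `V(J₂⁺(G))`
  and is not a flat; **`plane_family_blind`**: for ALL `b` with `b₁ = 0`, `b₃ + b₄ = 0` the state `G(x + b)` is blind at `q = 2`
  (`σ = (0, x₂, −x₄, x₄)`, `T = {x₁}`, `α₀ = e₁`).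

OURS; counted 0.  bears_on: LADDER-RESOLUTION:D157-DOOR2 (res-dim4-pi · ∀K column · uniform blindness over implicit loci).
Supports stmt-ResolutionOfSingularities-16155 (helper).
-/

set_option linter.dupNamespace false -- mandated namespace of this single-conjunct summit

noncomputable section

open MvPolynomial Finset
open scoped BigOperators

namespace Summit.ResolutionOfSingularities.ResolutionOfSingularities.Theorems.PIDim4

namespace ScopeBlind

open Literature.AlgebraicGeometry.Resolution
open Literature.AlgebraicGeometry.Resolution.CentreBlowup
open Literature.AlgebraicGeometry.Resolution.Hauser2010
open StepKit ScopeDynamics IsolationCert CurveBlind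

variable {K : Type} [Field K]

/-! ## §1 Plumbing -/

/-- evaluating after a polynomial substitution = evaluating at the substituted point. [folklore] -/
theorem eval_aeval_mv (σ : Fin 4 → MvPolynomial (Fin 4) K) (g : MvPolynomial (Fin 4) K) (x : Fin 4 → K) :
    MvPolynomial.eval x (MvPolynomial.aeval σ g) = MvPolynomial.eval (fun i => MvPolynomial.eval x (σ i)) g := by
  have h : (MvPolynomial.eval x).comp (MvPolynomial.aeval σ).toRingHom =
      MvPolynomial.eval (fun i => MvPolynomial.eval x (σ i)) := by
    refine MvPolynomial.ringHom_ext (fun c => ?_) (fun i => ?_)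
    · simp
    · simp
  exact congrArg (fun φ : MvPolynomial (Fin 4) K →+* K => φ g) h

/-- **killing `x_T` commutes with the translation by `b` when `b_T = 0`.** [folklore] -/
theorem aeval_killT_translate (T : Finset (Fin 4)) (b : Fin 4 → K) (hbT : ∀ i ∈ T, b i = 0) (G : MvPolynomial (Fin 4) K) :
    MvPolynomial.aeval (R := K) (fun i : Fin 4 => if i ∈ T then (0 : MvPolynomial (Fin 4) K) else X i)
        (PointBlowup.translate b G) =
      PointBlowup.translate b
        (MvPolynomial.aeval (R := K) (fun i : Fin 4 => if i ∈ T then (0 : MvPolynomial (Fin 4) K) else X i) G) := by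
  rw [translate_def, translate_def, ← AlgHom.comp_apply, ← AlgHom.comp_apply]
  have h : (MvPolynomial.aeval (R := K) (fun i : Fin 4 => if i ∈ T then (0 : MvPolynomial (Fin 4) K) else X i)).comp
        (MvPolynomial.aeval (R := K) fun i => (X i + C (b i) : MvPolynomial (Fin 4) K)) =
      (MvPolynomial.aeval (R := K) fun i => (X i + C (b i) : MvPolynomial (Fin 4) K)).comp
        (MvPolynomial.aeval (R := K) (fun i : Fin 4 => if i ∈ T then (0 : MvPolynomial (Fin 4) K) else X i)) := by
    refine MvPolynomial.algHom_ext fun i => ?_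
    simp only [AlgHom.comp_apply, MvPolynomial.aeval_X, map_add, MvPolynomial.algHom_C, MvPolynomial.algebraMap_eq]
    by_cases hi : i ∈ T
    · rw [if_pos hi, map_zero, zero_add, hbT i hi, C_0]
    · rw [if_neg hi, MvPolynomial.aeval_X]
  exact DFunLike.congr_fun h G

/-- translation is injective: `G(x + b) = 0 ⟹ G = 0`. [folklore] -/
theorem eq_zero_of_translate_eq_zero (b : Fin 4 → K) {G : MvPolynomial (Fin 4) K} (h : PointBlowup.translate b G = 0) :
    G = 0 := by
  have := congrArg (PointBlowup.translate (fun i => -b i)) h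
  rwa [PointBlowup.translate_neg_translate, translate_def, map_zero] at this

/-! ## §2 Uniform blindness over an implicit witness variety -/

/-- **UNIFORM-OUT BY SUBSTITUTION.**  Let `σ` be a polynomial substitution killing the coordinates `x_i`, `i ∈ T`, and
non-constant elsewhere, with `aeval σ (D^{(α)}G) = 0` for all `0 < |α| < q` (the witness ideal `ker (aeval σ)` contains
`J_q⁺(G)`), and let `(D^{(α₀)}G)(x_T ↦ 0) ≠ 0` for one `0 < |α₀| < q`.  Then at EVERY point `b` fixed by the substitution
(`eval b (σ i) = b i` — «`b` lies on the witness variety»; in particular `b_T = 0`) the translated state `G(x + b)` is OUT of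
coordinate scope. OURS. [cite: AtiyahMacdonald1969, Ch. 1 (prime ideals; minimal primes, Ex. 1.8)] -/
theorem not_inCoordinateScope_translate_of_subst {q : ℕ} (G : MvPolynomial (Fin 4) K)
    (σ : Fin 4 → MvPolynomial (Fin 4) K) (T : Finset (Fin 4)) (hσT : ∀ i ∈ T, σ i = 0)
    (hσ : ∀ i : Fin 4, i ∉ T → ∀ c : K, σ i ≠ C c)
    (hJ : ∀ α : Fin 4 →₀ ℕ, 0 < α.degree → α.degree < q → MvPolynomial.aeval σ (hasseDeriv α G) = 0)
    (α₀ : Fin 4 →₀ ℕ) (hα0 : 0 < α₀.degree) (hαq : α₀.degree < q)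
    (hW : MvPolynomial.aeval (R := K) (fun i : Fin 4 => if i ∈ T then (0 : MvPolynomial (Fin 4) K) else X i)
      (hasseDeriv α₀ G) ≠ 0)
    (b : Fin 4 → K) (hb : ∀ i : Fin 4, MvPolynomial.eval b (σ i) = b i) :
    ¬ InCoordinateScope q (PointBlowup.translate b G) := by
  classical
  have hbT : ∀ i ∈ T, b i = 0 := fun i hi => by rw [← hb i, hσT i hi, map_zero]
  let τ : MvPolynomial (Fin 4) K →ₐ[K] MvPolynomial (Fin 4) K :=
    MvPolynomial.aeval fun i => (X i + C (-b i) : MvPolynomial (Fin 4) K)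
  have hτ : ∀ g, τ g = PointBlowup.translate (fun i => -b i) g := fun g => rfl
  let ψ : MvPolynomial (Fin 4) K →+* MvPolynomial (Fin 4) K := (MvPolynomial.aeval σ).toRingHom.comp τ.toRingHom
  have hψ : ∀ g, ψ g = MvPolynomial.aeval σ (PointBlowup.translate (fun i => -b i) g) := fun g => rfl
  refine IsolationCert.not_inCoordinateScope_of_prime (P := RingHom.ker ψ) (RingHom.ker_isPrime ψ) ?_ ?_ T ?_ ?_
  · -- `J ≤ ker ψ`
    unfold singLocusIdeal
    rw [Ideal.span_le]
    rintro _ ⟨α, h0, hq, rfl⟩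
    rw [SetLike.mem_coe, RingHom.mem_ker, hψ, ScopeDynamics.hasseDeriv_translate, PointBlowup.translate_neg_translate]
    exact hJ α h0 hq
  · -- `ker ψ ≤ 𝔪₀`
    intro g hg
    rw [RingHom.mem_ker, hψ] at hg
    have h1 := congrArg (MvPolynomial.eval b) hg
    rw [eval_aeval_mv, map_zero, show (fun i => MvPolynomial.eval b (σ i)) = b from funext hb, eval_translate_add,
      show (b + fun i => -b i) = 0 from funext fun i => by simp] at h1
    unfold originIdeal
    rw [RingHom.mem_ker]
    exact h1
  · -- no `x_i`, `i ∉ T`, in `ker ψ`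
    intro i hi
    by_contra hiT
    rw [RingHom.mem_ker, hψ, translate_def, MvPolynomial.aeval_X, map_add, MvPolynomial.aeval_X, MvPolynomial.algHom_C,
      MvPolynomial.algebraMap_eq] at hi
    apply hσ i hiT (b i)
    have : σ i = -C (-b i) := eq_neg_of_add_eq_zero_left hi
    rw [this, map_neg, neg_neg]
  · -- `J ⊄ (x_T)`: kill `x_T` and undo the translation
    intro hle
    have hD : hasseDeriv α₀ (PointBlowup.translate b G) ∈ singLocusIdeal q (PointBlowup.translate b G) :=
      Ideal.subset_span ⟨α₀, hα0, hαq, rfl⟩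
    have hk := aeval_killT_eq_zero_of_mem_span T (hle hD)
    rw [ScopeDynamics.hasseDeriv_translate, aeval_killT_translate T b hbT] at hk
    exact hW (eq_zero_of_translate_eq_zero b hk)

/-- **The frame's child at such a point is OUT of coordinate scope** (`q = p` the characteristic: cleaning does not change
`J_p⁺`). OURS. [folklore] -/
theorem not_inCoordinateScope_step_of_subst (p : ℕ) [Fact p.Prime] [CharP K p] [DecidableEq K] (S : Finset (Fin 4))
    (j : Fin 4) (s : State K) (σ : Fin 4 → MvPolynomial (Fin 4) K) (T : Finset (Fin 4)) (hσT : ∀ i ∈ T, σ i = 0)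
    (hσ : ∀ i : Fin 4, i ∉ T → ∀ c : K, σ i ≠ C c)
    (hJ : ∀ α : Fin 4 →₀ ℕ, 0 < α.degree → α.degree < p →
      MvPolynomial.aeval σ (hasseDeriv α (chartTransform p S j s.F)) = 0)
    (α₀ : Fin 4 →₀ ℕ) (hα0 : 0 < α₀.degree) (hαq : α₀.degree < p)
    (hW : MvPolynomial.aeval (R := K) (fun i : Fin 4 => if i ∈ T then (0 : MvPolynomial (Fin 4) K) else X i)
      (hasseDeriv α₀ (chartTransform p S j s.F)) ≠ 0)
    (b : Fin 4 → K) (hb : ∀ i : Fin 4, MvPolynomial.eval b (σ i) = b i) :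
    ¬ InCoordinateScope p (CentreBlowup.step p S j b s).F := by
  have hF : (CentreBlowup.step p S j b s).F = deletePthPowers p (PointBlowup.translate b (chartTransform p S j s.F)) := rfl
  unfold InCoordinateScope
  rw [hF, IsolatedBand.singLocusIdeal_deletePthPowers]
  exact not_inCoordinateScope_translate_of_subst _ σ T hσT hσ hJ α₀ hα0 hαq hW b hb

/-! ## §3 Acceptance: a plane witness, every field, all points of the plane -/

/-- a coordinate is not a constant. [folklore] -/
theorem X_ne_C (i : Fin 4) (c : K) : (X i : MvPolynomial (Fin 4) K) ≠ C c := by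
  classical
  intro h
  have := congrArg (coeff (Finsupp.single i 1)) h
  rw [coeff_X, if_pos rfl, coeff_C, if_neg (Ne.symm (Finsupp.single_ne_zero.mpr one_ne_zero))] at this
  exact one_ne_zero this

/-- nor is its negative. [folklore] -/
theorem neg_X_ne_C (i : Fin 4) (c : K) : -(X i : MvPolynomial (Fin 4) K) ≠ C c := fun h =>
  X_ne_C i (-c) (by rw [map_neg, ← h, neg_neg])

/-- `x_i + x_k ≠ 0` for `i ≠ k`. [folklore] -/
theorem X_add_X_ne_zero {i k : Fin 4} (hik : i ≠ k) : (X i + X k : MvPolynomial (Fin 4) K) ≠ 0 := by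
  classical
  intro h
  have := congrArg (coeff (Finsupp.single i 1)) h
  rw [coeff_add, coeff_X, coeff_X, if_pos rfl, if_neg (fun h' => hik ((Finsupp.single_left_injective one_ne_zero) h').symm),
    add_zero, coeff_zero] at this
  exact one_ne_zero this

/-- the first Hasse derivatives of `x₁(x₃ + x₄)`. [folklore] -/
theorem hasseDeriv_plane_example (i : Fin 4) :
    hasseDeriv (Finsupp.single i 1) ((X 0 : MvPolynomial (Fin 4) K) * (X 2 + X 3)) =
      ![X 2 + X 3, 0, X 0, X 0] i := by
  rw [IsolationCert.hasseDeriv_single_one]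
  fin_cases i <;> simp [pderiv_X]

/-- `G = x₁(x₃ + x₄)`: its `2`-fold locus contains the NON-FLAT plane `{x₁ = 0, x₃ + x₄ = 0}`; at EVERY point `b` of that plane
(`b₁ = 0`, `b₃ + b₄ = 0`, any `b₂`) the translated state is OUT of coordinate scope at `q = 2` — over every field, one theorem,
substitution `σ = (0, x₂, −x₄, x₄)`. [OURS · instance] -/
theorem plane_family_blind (b : Fin 4 → K) (hb1 : b 0 = 0) (hb34 : b 2 + b 3 = 0) :
    ¬ InCoordinateScope 2 (PointBlowup.translate b ((X 0 : MvPolynomial (Fin 4) K) * (X 2 + X 3))) := by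
  classical
  refine not_inCoordinateScope_translate_of_subst (q := 2) _ ![0, X 1, -X 3, X 3] {0} (fun i hi => ?_) (fun i hi c => ?_)
    (fun α h0 h2 => ?_) (Finsupp.single 0 1) (by rw [Finsupp.degree_single]; omega) (by rw [Finsupp.degree_single]; omega)
    ?_ b (fun i => ?_)
  · rw [Finset.mem_singleton] at hi
    subst hi
    rfl
  · fin_cases i
    · exact absurd (Finset.mem_singleton_self _) hi
    · exact X_ne_C 1 c
    · exact neg_X_ne_C 3 c
    · exact X_ne_C 3 c
  · obtain ⟨i, rfl⟩ := IsolationCert.exists_eq_single_of_degree_eq_one (by omega : α.degree = 1)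
    rw [hasseDeriv_plane_example i]
    fin_cases i <;> simp
  · rw [hasseDeriv_plane_example 0]
    have h2 : (2 : Fin 4) ∉ ({0} : Finset (Fin 4)) := by decide
    have h3 : (3 : Fin 4) ∉ ({0} : Finset (Fin 4)) := by decide
    simp only [Matrix.cons_val_zero, map_add, MvPolynomial.aeval_X, if_neg h2, if_neg h3]
    exact X_add_X_ne_zero (by decide)
  · fin_cases i
    · simpa using hb1.symm
    · simp
    · have : b 2 = -b 3 := eq_neg_of_add_eq_zero_left hb34
      simpa using this.symm
    · simp

end ScopeBlind

end Summit.ResolutionOfSingularities.ResolutionOfSingularities.Theorems.PIDim4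

end
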